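import Mathlib.MeasureTheory.Integral.DominatedConvergence
import Mathlib.Analysis.Calculus.MeanValue
import Literature.Analysis.PDE.NewtonianPotential
import Summits.NavierStokesRegularity.NavierStokesRegularity.Theorems.HardyPointSinkHardyBalanceLawKernelMass
import Summits.NavierStokesRegularity.NavierStokesRegularity.Theorems.HardyPointSinkHardyBalanceLawWeights
import Summits.NavierStokesRegularity.NavierStokesRegularity.Theorems.HardyPointSinkHardyBalanceLawIntegrability
import HarnessLib
import Literature.Analysis.FluidPDE.MildSolutionProofs
import Literature.Analysis.FluidPDE.EnergyUniqueness
import Literature.Analysis.FluidPDE.PeriodicLerayProfileGradient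

/-!
# Route HardyPointSink — `HardyBalanceLaw`: the three principal limits

Helper file for item stmt-NavierStokesRegularity-8388 (`HardyBalanceLaw`). With the regularised,
cut-off Newtonian weight `ψ_n(x) = regKernel aₙ (x - x₀) χₙ(x)` (`aₙ → 0⁺`, `χₙ → 1`) inserted
in the local energy identity of a classical Navier–Stokes solution, three terms have nonzero
limits as `n → ∞`; this file computes them by dominated convergence / the approximate identity:

* the **Hardy-weight terms** `∫ G ψ_n → ∫ G / |x - x₀|` for a continuous `G = O((1+‖x‖)⁻⁴)`
  (used with `G = |u|²` and `G = |∇u|²`), dominated by `(1+‖x‖)⁻⁴|x - x₀|⁻¹`;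
* the **head-flux term** `∫ χₙ (‖x - x₀‖² + aₙ)^{-3/2} W → ∫ W / |x - x₀|³` for a continuous
  `W = O((1+‖x‖)⁻² |x - x₀|)` (used with `W = ⟨x - x₀, u⟩(|u|² + 2p)`), dominated by
  `(1+‖x‖)⁻²|x - x₀|⁻²`;
* the **point sink** `∫ regBump (εₙ²) (x - x₀) |v|² → 4π |v(x₀)|²` (the tree's approximate
  identity `Newtonian.tendsto_integral_mul_approxId`, mass `bumpMass ℝ³ = 4π`).

Each comes with the uniform bound needed for dominated convergence in time. The second part of
the file is the pointwise calculus of the cut-off weights `ψₙ = φₙ χₙ` (Leibniz rules for `Dψₙ`,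
`Δψₙ`, the splitting of the flux integrand) and the bounds on the slice data `|v|²`, `|∇v|²_F`,
`(|v|² + 2q)`, `⟨x - x₀, v⟩(|v|² + 2q)`.
-/

noncomputable section

open MeasureTheory Metric Set Filter Topology TopologicalSpace Function InnerProductSpace
open Literature.Analysis.PDE Literature.Analysis.FluidPDE
open scoped RealInnerProductSpace Laplacian NNReal Interval ContDiff

set_option linter.dupNamespace false -- nested layout Summit.<S>.<Sub>, Sub = S (D-0017)

namespace Summit.NavierStokesRegularity.NavierStokesRegularity.Theorems

/-! ### The Hardy-weight terms -/

/-- **The Hardy-weight limit.** For a continuous `G` with `|G| ≤ B(1+‖x‖)⁻⁴`, a sequence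
`aₙ → 0⁺` of positive regularisations and cut-offs `χₙ ∈ [0,1]` eventually `1` at each point,
`∫ G · regKernel aₙ (· - x₀) · χₙ → ∫ G / |x - x₀|`, with the uniform bound
`|∫ G ψₙ| ≤ B ∫ (1+‖x‖)⁻⁴|x - x₀|⁻¹`. -/
theorem hardyPointSink_tendsto_weight_term (x₀ : EuclideanSpace ℝ (Fin 3)) {a : ℕ → ℝ}
    (ha : ∀ n, 0 < a n)
    (hat : Tendsto a atTop (𝓝[≥] 0)) {χ : ℕ → (EuclideanSpace ℝ (Fin 3)) → ℝ}
    (hχc : ∀ n, Continuous (χ n))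
    (hχ0 : ∀ n x, 0 ≤ χ n x) (hχ1 : ∀ n x, χ n x ≤ 1) (hχe : ∀ x, ∀ᶠ n in atTop, χ n x = 1)
    {G : (EuclideanSpace ℝ (Fin 3)) → ℝ} (hG : Continuous G) {B : ℝ}
    (hGB : ∀ x, |G x| ≤ B * ((1 + ‖x‖) ^ 4)⁻¹) :
    Tendsto (fun n => ∫ x, G x * (Newtonian.regKernel (a n) (x - x₀) * χ n x)) atTop
        (𝓝 (∫ x, G x / ‖x - x₀‖)) ∧
      (∀ n, |∫ x, G x * (Newtonian.regKernel (a n) (x - x₀) * χ n x)| ≤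
        B * ∫ x : EuclideanSpace ℝ (Fin 3), ((1 + ‖x‖) ^ 4)⁻¹ * ‖x - x₀‖⁻¹) ∧
      ∀ n, Integrable (fun x => G x * (Newtonian.regKernel (a n) (x - x₀) * χ n x)) := by
  have hφc : ∀ n, Continuous fun x : EuclideanSpace ℝ (Fin 3) => Newtonian.regKernel (a n) (x - x₀) := fun n =>
    (hardyPointSink_contDiff_weight (ha n) x₀ (m := 0)).continuous
  have key := hardyPointSink_dct (F := fun n x => G x * (Newtonian.regKernel (a n) (x - x₀) * χ n x))
    (f := fun x => G x / ‖x - x₀‖)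
    (bound := fun x => B * (((1 + ‖x‖) ^ 4)⁻¹ * ‖x - x₀‖⁻¹))
    (fun n => ((hG.mul ((hφc n).mul (hχc n))).aestronglyMeasurable))
    ((hardyPointSink_integrable_FA x₀).const_mul B) ?_ ?_
  · rw [integral_const_mul] at key
    exact key
  · intro n
    filter_upwards [hardyPointSink_ae_ne x₀] with x hx
    have hx' : x - x₀ ≠ 0 := sub_ne_zero.2 hx
    have hk0 : 0 ≤ Newtonian.regKernel (a n) (x - x₀) := hardyPointSink_regKernel_nonneg (ha n).le _
    have hk1 : Newtonian.regKernel (a n) (x - x₀) ≤ ‖x - x₀‖⁻¹ :=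
      hardyPointSink_regKernel_le_inv_norm (ha n).le hx'
    rw [Real.norm_eq_abs, abs_mul, abs_mul, abs_of_nonneg hk0, abs_of_nonneg (hχ0 n x)]
    have h4 : 0 ≤ ((1 + ‖x‖) ^ 4)⁻¹ := by positivity
    calc |G x| * (Newtonian.regKernel (a n) (x - x₀) * χ n x)
        ≤ B * ((1 + ‖x‖) ^ 4)⁻¹ * (‖x - x₀‖⁻¹ * 1) :=
          mul_le_mul (hGB x) (mul_le_mul hk1 (hχ1 n x) (hχ0 n x) (inv_nonneg.2 (norm_nonneg _)))
            (mul_nonneg hk0 (hχ0 n x)) ((abs_nonneg _).trans (hGB x))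
      _ = B * (((1 + ‖x‖) ^ 4)⁻¹ * ‖x - x₀‖⁻¹) := by ring
  · filter_upwards [hardyPointSink_ae_ne x₀] with x hx
    have hx' : x - x₀ ≠ 0 := sub_ne_zero.2 hx
    have h1 : Tendsto (fun n => Newtonian.regKernel (a n) (x - x₀)) atTop (𝓝 ‖x - x₀‖⁻¹) :=
      (hardyPointSink_tendsto_regKernel hx').comp hat
    have h2 : Tendsto (fun n => χ n x) atTop (𝓝 1) :=
      tendsto_const_nhds.congr' (by filter_upwards [hχe x] with n hn using hn.symm)
    have h3 := (h1.mul h2).const_mul (G x)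
    rw [mul_one, ← div_eq_mul_inv] at h3
    exact h3

/-! ### The head-flux term -/

/-- **The head-flux limit.** For a continuous `W` with `|W| ≤ B(1+‖x‖)⁻²|x - x₀|`,
`∫ χₙ (‖x - x₀‖² + aₙ)^{-3/2} W → ∫ W / |x - x₀|³`, with the uniform bound
`B ∫ (1+‖x‖)⁻²|x - x₀|⁻²`. -/
theorem hardyPointSink_tendsto_flux_term (x₀ : EuclideanSpace ℝ (Fin 3)) {a : ℕ → ℝ}
    (ha : ∀ n, 0 < a n)
    (hat : Tendsto a atTop (𝓝[≥] 0)) {χ : ℕ → (EuclideanSpace ℝ (Fin 3)) → ℝ}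
    (hχc : ∀ n, Continuous (χ n))
    (hχ0 : ∀ n x, 0 ≤ χ n x) (hχ1 : ∀ n x, χ n x ≤ 1) (hχe : ∀ x, ∀ᶠ n in atTop, χ n x = 1)
    {W : (EuclideanSpace ℝ (Fin 3)) → ℝ} (hW : Continuous W) {B : ℝ}
    (hWB : ∀ x, |W x| ≤ B * ((1 + ‖x‖) ^ 2)⁻¹ * ‖x - x₀‖) :
    Tendsto (fun n => ∫ x, χ n x * (‖x - x₀‖ ^ 2 + a n) ^ (-3 / 2 : ℝ) * W x) atTop
        (𝓝 (∫ x, W x / ‖x - x₀‖ ^ 3)) ∧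
      (∀ n, |∫ x, χ n x * (‖x - x₀‖ ^ 2 + a n) ^ (-3 / 2 : ℝ) * W x| ≤
        B * ∫ x : EuclideanSpace ℝ (Fin 3), ((1 + ‖x‖) ^ 2)⁻¹ * (‖x - x₀‖ ^ 2)⁻¹) ∧
      ∀ n, Integrable (fun x => χ n x * (‖x - x₀‖ ^ 2 + a n) ^ (-3 / 2 : ℝ) * W x) := by
  have hρc : ∀ n, Continuous fun x : EuclideanSpace ℝ (Fin 3) => (‖x - x₀‖ ^ 2 + a n) ^ (-3 / 2 : ℝ) := fun n =>
    Continuous.rpow_const (by fun_prop) fun x => Or.inl (hardyPointSink_base_pos (ha n) x₀ x).ne'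
  have key := hardyPointSink_dct
    (F := fun n x => χ n x * (‖x - x₀‖ ^ 2 + a n) ^ (-3 / 2 : ℝ) * W x)
    (f := fun x => W x / ‖x - x₀‖ ^ 3)
    (bound := fun x => B * (((1 + ‖x‖) ^ 2)⁻¹ * (‖x - x₀‖ ^ 2)⁻¹))
    (fun n => (((hχc n).mul (hρc n)).mul hW).aestronglyMeasurable)
    ((hardyPointSink_integrable_FC x₀).const_mul B) ?_ ?_
  · rw [integral_const_mul] at key
    exact key
  · intro n
    filter_upwards [hardyPointSink_ae_ne x₀] with x hx
    have hx' : x - x₀ ≠ 0 := sub_ne_zero.2 hx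
    have hr : 0 < ‖x - x₀‖ := norm_pos_iff.2 hx'
    have hρ0 : 0 ≤ (‖x - x₀‖ ^ 2 + a n) ^ (-3 / 2 : ℝ) :=
      Real.rpow_nonneg (hardyPointSink_base_pos (ha n) x₀ x).le _
    have hρ1 := hardyPointSink_rho_mul_norm_le (ha n).le hx'
    have hB : 0 ≤ B * ((1 + ‖x‖) ^ 2)⁻¹ := by
      by_contra hneg
      have h' : B * ((1 + ‖x‖) ^ 2)⁻¹ * ‖x - x₀‖ < 0 :=
        mul_neg_of_neg_of_pos (not_le.mp hneg) hr
      linarith [(abs_nonneg _).trans (hWB x)]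
    rw [Real.norm_eq_abs, abs_mul, abs_mul, abs_of_nonneg (hχ0 n x), abs_of_nonneg hρ0]
    calc χ n x * (‖x - x₀‖ ^ 2 + a n) ^ (-3 / 2 : ℝ) * |W x|
        ≤ 1 * (‖x - x₀‖ ^ 2 + a n) ^ (-3 / 2 : ℝ) * (B * ((1 + ‖x‖) ^ 2)⁻¹ * ‖x - x₀‖) :=
          mul_le_mul (mul_le_mul_of_nonneg_right (hχ1 n x) hρ0) (hWB x) (abs_nonneg _)
            (by positivity)
      _ = B * ((1 + ‖x‖) ^ 2)⁻¹ * ((‖x - x₀‖ ^ 2 + a n) ^ (-3 / 2 : ℝ) * ‖x - x₀‖) := by ring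
      _ ≤ B * ((1 + ‖x‖) ^ 2)⁻¹ * (‖x - x₀‖ ^ 2)⁻¹ := mul_le_mul_of_nonneg_left hρ1 hB
      _ = B * (((1 + ‖x‖) ^ 2)⁻¹ * (‖x - x₀‖ ^ 2)⁻¹) := by ring
  · filter_upwards [hardyPointSink_ae_ne x₀] with x hx
    have hx' : x - x₀ ≠ 0 := sub_ne_zero.2 hx
    have h1 : Tendsto (fun n => (‖x - x₀‖ ^ 2 + a n) ^ (-3 / 2 : ℝ)) atTop
        (𝓝 (‖x - x₀‖ ^ 3)⁻¹) := (hardyPointSink_tendsto_rho hx').comp hat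
    have h2 : Tendsto (fun n => χ n x) atTop (𝓝 1) :=
      tendsto_const_nhds.congr' (by filter_upwards [hχe x] with n hn using hn.symm)
    have h3 := (h2.mul h1).mul_const (W x)
    rw [one_mul, inv_mul_eq_div] at h3
    exact h3

/-! ### The point sink -/

/-- `|v|²` is Lipschitz when `v` and `Dv` are bounded. -/
theorem hardyPointSink_lipschitz_norm_sq
    {v : (EuclideanSpace ℝ (Fin 3)) → (EuclideanSpace ℝ (Fin 3))} (hv : ContDiff ℝ 1 v) {C : ℝ}
    (hC : 0 ≤ C) (hvb : ∀ x, ‖v x‖ ≤ C) (hDv : ∀ x, ‖fderiv ℝ v x‖ ≤ C) :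
    LipschitzWith ⟨2 * C * C, by positivity⟩ (fun x => ‖v x‖ ^ 2) := by
  have hd : Differentiable ℝ v := hv.differentiable one_ne_zero
  have hd2 : Differentiable ℝ fun x => ‖v x‖ ^ 2 := fun x => (hd x).norm_sq ℝ
  refine lipschitzWith_of_nnnorm_fderiv_le hd2 fun x => ?_
  have hD : fderiv ℝ (fun y => ‖v y‖ ^ 2) x = 2 • (innerSL ℝ (v x)).comp (fderiv ℝ v x) :=
    ((hd x).hasFDerivAt.norm_sq).fderiv
  rw [← NNReal.coe_le_coe, coe_nnnorm, hD]
  change ‖(2 : ℕ) • (innerSL ℝ (v x)).comp (fderiv ℝ v x)‖ ≤ 2 * C * C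
  calc ‖(2 : ℕ) • (innerSL ℝ (v x)).comp (fderiv ℝ v x)‖
      ≤ 2 * ‖(innerSL ℝ (v x)).comp (fderiv ℝ v x)‖ := by
        rw [two_smul, two_mul]; exact norm_add_le _ _
    _ ≤ 2 * (‖innerSL ℝ (v x)‖ * ‖fderiv ℝ v x‖) := by
        gcongr; exact ContinuousLinearMap.opNorm_comp_le _ _
    _ ≤ 2 * (C * C) := by
        rw [innerSL_apply_norm]
        gcongr
        · exact hvb x
        · exact hDv x
    _ = 2 * C * C := by ring

/-- `regBump` is even. -/
theorem hardyPointSink_regBump_neg (a : ℝ) (ξ : EuclideanSpace ℝ (Fin 3)) :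
    Newtonian.regBump a (-ξ) = Newtonian.regBump a ξ := by
  simp [Newtonian.regBump, norm_neg]

/-- **The point sink** (approximate identity with mass `4π`): for a `C¹` field `v` with `v`, `Dv`
bounded by `C` and scales `εₙ → 0⁺`,
`∫ regBump (εₙ²) (x - x₀) |v(x)|² dx → 4π |v(x₀)|²`, with the uniform bound `4π C²`. -/
theorem hardyPointSink_tendsto_sink (x₀ : EuclideanSpace ℝ (Fin 3)) {ε : ℕ → ℝ} (hε : ∀ n, 0 < ε n)
    (hεt : Tendsto ε atTop (𝓝[>] 0)) {v : (EuclideanSpace ℝ (Fin 3)) → (EuclideanSpace ℝ (Fin 3))}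
    (hv : ContDiff ℝ 1 v) {C : ℝ} (hC : 0 ≤ C)
    (hvb : ∀ x, ‖v x‖ ≤ C) (hDv : ∀ x, ‖fderiv ℝ v x‖ ≤ C) :
    Tendsto (fun n => ∫ x, Newtonian.regBump (ε n ^ 2) (x - x₀) * ‖v x‖ ^ 2) atTop
        (𝓝 (4 * Real.pi * ‖v x₀‖ ^ 2)) ∧
      (∀ n, |∫ x, Newtonian.regBump (ε n ^ 2) (x - x₀) * ‖v x‖ ^ 2| ≤ 4 * Real.pi * C ^ 2) ∧
      ∀ n, Integrable (fun x => Newtonian.regBump (ε n ^ 2) (x - x₀) * ‖v x‖ ^ 2) := by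
  have hn3 := hardyPointSink_three_le_finrank
  have hA := hardyPointSink_bumpMass_fin_three
  have hApos : 0 < Newtonian.bumpMass (EuclideanSpace ℝ (Fin 3)) := Newtonian.bumpMass_pos hn3
  -- rewrite the bump through the normalised approximate identity, reflected
  have hK : ∀ n (x : EuclideanSpace ℝ (Fin 3)), Newtonian.regBump (ε n ^ 2) (x - x₀) =
      Newtonian.bumpMass (EuclideanSpace ℝ (Fin 3)) * Newtonian.approxId (ε n ^ 2) (x₀ - x) := by
    intro n x
    rw [Newtonian.approxId, ← mul_assoc, mul_inv_cancel₀ hApos.ne', one_mul, ← neg_sub,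
      hardyPointSink_regBump_neg]
  have hI : ∀ n, ∫ x, Newtonian.regBump (ε n ^ 2) (x - x₀) * ‖v x‖ ^ 2 =
      Newtonian.bumpMass (EuclideanSpace ℝ (Fin 3)) * ∫ x, ‖v x‖ ^ 2 * Newtonian.approxId (ε n ^ 2) (x₀ - x) := by
    intro n
    rw [← integral_const_mul]
    refine integral_congr_ae (Eventually.of_forall fun x => ?_)
    simp only [hK n x]
    ring
  -- the approximate identity
  have hgc : Continuous fun x => ‖v x‖ ^ 2 := (hv.continuous.norm).pow 2
  have hgu : UniformContinuous fun x => ‖v x‖ ^ 2 :=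
    (hardyPointSink_lipschitz_norm_sq hv hC hvb hDv).uniformContinuous
  have hgM : ∀ x, |‖v x‖ ^ 2| ≤ C ^ 2 := fun x => by
    rw [abs_of_nonneg (sq_nonneg _)]
    exact pow_le_pow_left₀ (norm_nonneg _) (hvb x) 2
  have hlim := (Newtonian.tendsto_integral_mul_approxId hn3 hgc hgu hgM x₀).comp hεt
  have hKi : ∀ n, Integrable fun x : EuclideanSpace ℝ (Fin 3) =>
      Newtonian.regBump (ε n ^ 2) (x - x₀) := fun n =>
    (Newtonian.integrable_regBump_sq (hε n)).comp_sub_right x₀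
  refine ⟨?_, fun n => ?_, fun n => ?_⟩
  · have h2 := hlim.const_mul (Newtonian.bumpMass (EuclideanSpace ℝ (Fin 3)))
    rw [hA] at h2
    refine h2.congr fun n => ?_
    simp only [Function.comp_def]
    rw [hI n, hA]
  · -- the uniform bound `∫ regBump |v|² ≤ C² ∫ regBump = 4π C²`
    have hKi := hKi n
    have hKint : ∫ x : EuclideanSpace ℝ (Fin 3), Newtonian.regBump (ε n ^ 2) (x - x₀) = 4 * Real.pi := by
      rw [integral_sub_right_eq_self (fun ξ : EuclideanSpace ℝ (Fin 3) => Newtonian.regBump (ε n ^ 2) ξ) x₀,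
        Newtonian.integral_regBump_sq (hε n), hA]
    have hK0 : ∀ x : EuclideanSpace ℝ (Fin 3), 0 ≤ Newtonian.regBump (ε n ^ 2) (x - x₀) := fun x =>
      hardyPointSink_regBump_nonneg (by positivity) _
    have hb : ∀ x : EuclideanSpace ℝ (Fin 3), ‖Newtonian.regBump (ε n ^ 2) (x - x₀) * ‖v x‖ ^ 2‖ ≤
        C ^ 2 * Newtonian.regBump (ε n ^ 2) (x - x₀) := fun x => by
      rw [Real.norm_eq_abs, abs_mul, abs_of_nonneg (hK0 x), mul_comm]
      exact mul_le_mul_of_nonneg_right (hgM x) (hK0 x)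
    calc |∫ x, Newtonian.regBump (ε n ^ 2) (x - x₀) * ‖v x‖ ^ 2|
        ≤ ∫ x, C ^ 2 * Newtonian.regBump (ε n ^ 2) (x - x₀) := by
          rw [← Real.norm_eq_abs]
          exact norm_integral_le_of_norm_le (hKi.const_mul _) (Eventually.of_forall hb)
      _ = 4 * Real.pi * C ^ 2 := by rw [integral_const_mul, hKint]; ring
  · have h := (hKi n).bdd_mul (c := C ^ 2) hgc.aestronglyMeasurable
      (Eventually.of_forall fun x => by rw [Real.norm_eq_abs]; exact hgM x)
    simpa only [mul_comm] using h

/-! ## Part II: pointwise calculus of `ψₙ` and the slice data -/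


/-! ### Pointwise calculus of `ψₙ = φₙ χₙ` -/

/-- **Leibniz rule for `Dψₙ`**:
`Dψₙ(x) w = φₙ(x) Dχₙ(x) w + χₙ(x) · (-(‖x-x₀‖² + aₙ)^{-3/2} ⟨x - x₀, w⟩)`. -/
theorem hardyPointSink_fderiv_psi (x₀ : EuclideanSpace ℝ (Fin 3)) {a : ℝ} (ha : 0 < a)
    {χ : EuclideanSpace ℝ (Fin 3) → ℝ} (hχ : ContDiff ℝ 1 χ) (x w : EuclideanSpace ℝ (Fin 3)) :
    fderiv ℝ (fun y => Newtonian.regKernel a (y - x₀) * χ y) x w =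
      Newtonian.regKernel a (x - x₀) * fderiv ℝ χ x w +
        χ x * (-(‖x - x₀‖ ^ 2 + a) ^ (-3 / 2 : ℝ) * ⟪x - x₀, w⟫) := by
  have hφd : DifferentiableAt ℝ (fun y : EuclideanSpace ℝ (Fin 3) => Newtonian.regKernel a (y - x₀)) x :=
    (hardyPointSink_hasFDerivAt_weight ha x₀ x).differentiableAt
  have hχd : DifferentiableAt ℝ χ x := hχ.differentiable one_ne_zero x
  rw [fderiv_fun_mul hφd hχd, add_apply, FunLike.coe_smul, FunLike.coe_smul,
    Pi.smul_apply, Pi.smul_apply, smul_eq_mul, smul_eq_mul,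
    hardyPointSink_fderiv_weight_apply ha x₀ x w]

/-- **Leibniz rule for `Δψₙ`**:
`Δψₙ = φₙ Δχₙ + 2 Σᵢ Dφₙ(eᵢ) Dχₙ(eᵢ) - regBump aₙ (· - x₀) χₙ`. -/
theorem hardyPointSink_laplacian_psi (x₀ : EuclideanSpace ℝ (Fin 3)) {a : ℝ} (ha : 0 < a)
    {χ : EuclideanSpace ℝ (Fin 3) → ℝ} (hχ : ContDiff ℝ 2 χ) (x : EuclideanSpace ℝ (Fin 3)) :
    (Δ (fun y => Newtonian.regKernel a (y - x₀) * χ y)) x =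
      Newtonian.regKernel a (x - x₀) * (Δ χ) x +
        2 * ∑ i, fderiv ℝ (fun y : EuclideanSpace ℝ (Fin 3) => Newtonian.regKernel a (y - x₀)) x
            (stdOrthonormalBasis ℝ (EuclideanSpace ℝ (Fin 3)) i) *
          fderiv ℝ χ x (stdOrthonormalBasis ℝ (EuclideanSpace ℝ (Fin 3)) i) +
        -Newtonian.regBump a (x - x₀) * χ x := by
  have hφ2 : ContDiff ℝ 2 (fun y : EuclideanSpace ℝ (Fin 3) => Newtonian.regKernel a (y - x₀)) :=
    hardyPointSink_contDiff_weight ha x₀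
  have e : (fun y : EuclideanSpace ℝ (Fin 3) => Newtonian.regKernel a (y - x₀) * χ y) =
      fun y => Newtonian.regKernel a (y - x₀) • χ y := rfl
  rw [e, laplacian_smul_apply hφ2 hχ x, hardyPointSink_laplacian_weight ha x₀ x]
  simp only [smul_eq_mul]

/-- **The pointwise splitting of the flux integrand** into the point sink, the bump tail, the
cross term, the cut-off Laplacian term, the head flux and the cut-off gradient term. -/
theorem hardyPointSink_flux_integrand_eq (x₀ : EuclideanSpace ℝ (Fin 3)) (ν : ℝ) {a : ℝ}
    (ha : 0 < a)
    {χ : EuclideanSpace ℝ (Fin 3) → ℝ} (hχ : ContDiff ℝ 2 χ)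
    (v : EuclideanSpace ℝ (Fin 3) → EuclideanSpace ℝ (Fin 3))
    (q : EuclideanSpace ℝ (Fin 3) → ℝ) (x : EuclideanSpace ℝ (Fin 3)) :
    ν * ((Δ (fun y => Newtonian.regKernel a (y - x₀) * χ y)) x * ‖v x‖ ^ 2) +
        fderiv ℝ (fun y => Newtonian.regKernel a (y - x₀) * χ y) x (v x) * ‖v x‖ ^ 2 +
        2 * (q x * fderiv ℝ (fun y => Newtonian.regKernel a (y - x₀) * χ y) x (v x)) =
      (-ν) * (Newtonian.regBump a (x - x₀) * ‖v x‖ ^ 2) +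
      ν * (Newtonian.regBump a (x - x₀) * (1 - χ x) * ‖v x‖ ^ 2) +
      (2 * ν) * ((∑ i, fderiv ℝ (fun y : EuclideanSpace ℝ (Fin 3) => Newtonian.regKernel a (y - x₀)) x
            (stdOrthonormalBasis ℝ (EuclideanSpace ℝ (Fin 3)) i) *
          fderiv ℝ χ x (stdOrthonormalBasis ℝ (EuclideanSpace ℝ (Fin 3)) i)) * ‖v x‖ ^ 2) +
      ν * ((Δ χ) x * Newtonian.regKernel a (x - x₀) * ‖v x‖ ^ 2) -
      χ x * (‖x - x₀‖ ^ 2 + a) ^ (-3 / 2 : ℝ) * (⟪x - x₀, v x⟫ * (‖v x‖ ^ 2 + 2 * q x)) +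
      Newtonian.regKernel a (x - x₀) * fderiv ℝ χ x (v x) * (‖v x‖ ^ 2 + 2 * q x) := by
  rw [hardyPointSink_laplacian_psi x₀ ha hχ x,
    hardyPointSink_fderiv_psi x₀ ha (hχ.of_le one_le_two) x (v x)]
  ring

/-! ### The slice data: bounds on `|v|²`, `|∇v|²`, the head `(|v|² + 2q)` -/

/-- `((1 + ‖x‖)²)⁻¹ · ((1 + ‖x‖)²)⁻¹ = ((1 + ‖x‖)⁴)⁻¹`. -/
theorem hardyPointSink_inv_sq_mul_inv_sq (x : EuclideanSpace ℝ (Fin 3)) :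
    ((1 + ‖x‖) ^ 2)⁻¹ * ((1 + ‖x‖) ^ 2)⁻¹ = ((1 + ‖x‖) ^ 4)⁻¹ := by
  rw [← mul_inv]; congr 1; ring

/-- The bound `|‖v‖²| ≤ C² (1+‖x‖)⁻⁴`. -/
theorem hardyPointSink_abs_norm_sq_le {v : EuclideanSpace ℝ (Fin 3) → EuclideanSpace ℝ (Fin 3)}
    {C : ℝ} (hC : 0 ≤ C)
    (hvC : ∀ x, ‖v x‖ ≤ C * ((1 + ‖x‖) ^ 2)⁻¹) (x : EuclideanSpace ℝ (Fin 3)) :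
    |‖v x‖ ^ 2| ≤ C ^ 2 * ((1 + ‖x‖) ^ 4)⁻¹ := by
  rw [abs_of_nonneg (sq_nonneg _), ← hardyPointSink_inv_sq_mul_inv_sq]
  have h0 : 0 ≤ ((1 + ‖x‖) ^ 2)⁻¹ := by positivity
  calc ‖v x‖ ^ 2 = ‖v x‖ * ‖v x‖ := sq _
    _ ≤ (C * ((1 + ‖x‖) ^ 2)⁻¹) * (C * ((1 + ‖x‖) ^ 2)⁻¹) :=
        mul_le_mul (hvC x) (hvC x) (norm_nonneg _) (mul_nonneg hC h0)
    _ = C ^ 2 * (((1 + ‖x‖) ^ 2)⁻¹ * ((1 + ‖x‖) ^ 2)⁻¹) := by ring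

/-- The bound `|∇v|²_F ≤ 3C² (1+‖x‖)⁻⁴`. -/
theorem hardyPointSink_abs_frobenius_le {v : EuclideanSpace ℝ (Fin 3) → EuclideanSpace ℝ (Fin 3)}
    {C : ℝ}
    (hDvC : ∀ x, ‖fderiv ℝ v x‖ ≤ C * ((1 + ‖x‖) ^ 2)⁻¹) (x : EuclideanSpace ℝ (Fin 3)) :
    |frobeniusNormSq (fderiv ℝ v x)| ≤ 3 * C ^ 2 * ((1 + ‖x‖) ^ 4)⁻¹ := by
  rw [abs_of_nonneg (frobeniusNormSq_nonneg _), ← hardyPointSink_inv_sq_mul_inv_sq]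
  have h0 : 0 ≤ ((1 + ‖x‖) ^ 2)⁻¹ := by positivity
  calc frobeniusNormSq (fderiv ℝ v x) ≤ 3 * ‖fderiv ℝ v x‖ ^ 2 :=
        BradshawTsai2017.frobeniusNormSq_le_three_mul_norm_sq _
    _ = 3 * (‖fderiv ℝ v x‖ * ‖fderiv ℝ v x‖) := by rw [sq]
    _ ≤ 3 * (C * ((1 + ‖x‖) ^ 2)⁻¹) ^ 2 := by
        rw [← sq]
        gcongr
        exact hDvC x
    _ = 3 * C ^ 2 * (((1 + ‖x‖) ^ 2)⁻¹ * ((1 + ‖x‖) ^ 2)⁻¹) := by ring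

/-- `‖w x‖ ≤ C` from the weighted bound `‖w x‖ ≤ C (1+‖x‖)⁻²`. -/
theorem hardyPointSink_norm_le_of_weighted {F : Type*} [NormedAddCommGroup F]
    {v : EuclideanSpace ℝ (Fin 3) → F} {C : ℝ} (hC : 0 ≤ C)
    (hvC : ∀ x, ‖v x‖ ≤ C * ((1 + ‖x‖) ^ 2)⁻¹) (x : EuclideanSpace ℝ (Fin 3)) : ‖v x‖ ≤ C :=
  (hvC x).trans (mul_le_of_le_one_right hC (hardyPointSink_inv_one_add_norm_pow_le_one x 2))

/-- The head factor `S = |v|² + 2q` is bounded by `C² + 2C`. -/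
theorem hardyPointSink_abs_head_le {v : EuclideanSpace ℝ (Fin 3) → EuclideanSpace ℝ (Fin 3)}
    {q : EuclideanSpace ℝ (Fin 3) → ℝ} {C : ℝ}
    (hC : 0 ≤ C) (hvC : ∀ x, ‖v x‖ ≤ C * ((1 + ‖x‖) ^ 2)⁻¹) (hqC : ∀ x, |q x| ≤ C)
    (x : EuclideanSpace ℝ (Fin 3)) :
    |‖v x‖ ^ 2 + 2 * q x| ≤ C ^ 2 + 2 * C := by
  have h1 : ‖v x‖ ≤ C := hardyPointSink_norm_le_of_weighted hC hvC x
  have h2 : ‖v x‖ ^ 2 ≤ C ^ 2 := pow_le_pow_left₀ (norm_nonneg _) h1 2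
  have h3 := hqC x
  rw [abs_le] at h3 ⊢
  constructor <;> nlinarith [sq_nonneg ‖v x‖]

/-- The head flux density `W = ⟨x - x₀, v⟩(|v|² + 2q)` satisfies
`|W| ≤ C(C² + 2C) (1+‖x‖)⁻² ‖x - x₀‖`. -/
theorem hardyPointSink_abs_headFlux_le (x₀ : EuclideanSpace ℝ (Fin 3))
    {v : EuclideanSpace ℝ (Fin 3) → EuclideanSpace ℝ (Fin 3)} {q : EuclideanSpace ℝ (Fin 3) → ℝ}
    {C : ℝ} (hC : 0 ≤ C) (hvC : ∀ x, ‖v x‖ ≤ C * ((1 + ‖x‖) ^ 2)⁻¹) (hqC : ∀ x, |q x| ≤ C)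
    (x : EuclideanSpace ℝ (Fin 3)) :
    |⟪x - x₀, v x⟫ * (‖v x‖ ^ 2 + 2 * q x)| ≤
      C * (C ^ 2 + 2 * C) * ((1 + ‖x‖) ^ 2)⁻¹ * ‖x - x₀‖ := by
  rw [abs_mul]
  have h1 : |⟪x - x₀, v x⟫| ≤ ‖x - x₀‖ * (C * ((1 + ‖x‖) ^ 2)⁻¹) :=
    (abs_real_inner_le_norm _ _).trans (mul_le_mul_of_nonneg_left (hvC x) (norm_nonneg _))
  have h2 := hardyPointSink_abs_head_le hC hvC hqC x
  calc |⟪x - x₀, v x⟫| * |‖v x‖ ^ 2 + 2 * q x|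
      ≤ ‖x - x₀‖ * (C * ((1 + ‖x‖) ^ 2)⁻¹) * (C ^ 2 + 2 * C) :=
        mul_le_mul h1 h2 (abs_nonneg _) (by positivity)
    _ = C * (C ^ 2 + 2 * C) * ((1 + ‖x‖) ^ 2)⁻¹ * ‖x - x₀‖ := by ring

/-- The head flux limit density, rewritten: `W/|x-x₀|³ = 2 · ((|v|²/2 + q) ⟨v, x-x₀⟩ / |x-x₀|³)`. -/
theorem hardyPointSink_headFlux_div_eq (x₀ : EuclideanSpace ℝ (Fin 3))
    (v : EuclideanSpace ℝ (Fin 3) → EuclideanSpace ℝ (Fin 3)) (q : EuclideanSpace ℝ (Fin 3) → ℝ)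
    (x : EuclideanSpace ℝ (Fin 3)) :
    ⟪x - x₀, v x⟫ * (‖v x‖ ^ 2 + 2 * q x) / ‖x - x₀‖ ^ 3 =
      2 * ((‖v x‖ ^ 2 / 2 + q x) * ⟪v x, x - x₀⟫ / ‖x - x₀‖ ^ 3) := by
  rw [real_inner_comm (x - x₀) (v x)]
  ring

end Summit.NavierStokesRegularity.NavierStokesRegularity.Theorems

end
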